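import Summits.HubbardSuperconductivity.HubbardSuperconductivity.Theorems.AnisotropyChordTransferFibre3RowDTriple
import Summits.HubbardSuperconductivity.HubbardSuperconductivity.Theorems.AnisotropyChordTransferFibre3RowDFourier

/-!
# Route `AnisotropyChord` / H0 rotor rung: PartN41-D §4 — `C0MonoTransform` and `FfacDictionary` PROVED

Theory-1 g22's PartN41-D §4 (port …Fibre3KT2aRow): ★ `c0MonoTransform_holds : C0MonoTransform L` — the transform of a trilinear
`C0` monomial `c0form3(Fa,Fb,Fc)` is `−½Σ_e` of three triple convolutions of (gradient-weighted) slot transforms: each of the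
twelve products is a `prod3` of profiles or lattice gradients of profiles (★ `c0form3_eq_prod3`), so `TripleConvolution`
(`RowD.cfgDFT_prod3`) and `DgradTransform` apply slotwise, with `cfgDFT` additive (★ `cfgDFT_add'`, `cfgDFT_smul'`);
★ `ffacDictionary_holds : FfacDictionary L` (the `Option`-free spec language, by unfolding).
Prover seat `hubbard-h0-rotor-p1` g27 (route lead); helper for stmt-HubbardSuperconductivity-23918 (`--supports`, helper class).
WHAT THIS IS NOT: nothing here proves superconductivity in the Hubbard model.  Tree imports only; no new definitions; no sorry.
-/

set_option linter.dupNamespace false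
set_option autoImplicit false

noncomputable section

open scoped BigOperators

namespace Summit.HubbardSuperconductivity.HubbardSuperconductivity.Theorems.AnisotropyChord.Transfer.Fibre3

variable (L : ℕ) [NeZero L]

namespace RowD

omit [NeZero L] in
/-- a `nnList` sum is the four-term sum, complex-valued version. [folklore] -/
theorem nnList_map_sum_complex (h : Tor L → ℂ) :
    ((nnList L).map h).sum = h (ex L) + h (-ex L) + h (ey L) + h (-ey L) := by
  rw [← neg_ex, ← neg_ey]
  simp only [nnList, ex, ey, List.map_cons, List.map_nil, List.sum_cons, List.sum_nil]
  ring

/-- `cfgDFT` is additive. [folklore] -/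
theorem cfgDFT_add' (F G : Cfg L → ℂ) (k₂ k₃ : Tor L) :
    cfgDFT L (fun c => F c + G c) k₂ k₃ = cfgDFT L F k₂ k₃ + cfgDFT L G k₂ k₃ := by
  unfold cfgDFT; rw [← Finset.sum_add_distrib]; exact Finset.sum_congr rfl fun c _ => by ring

/-- `cfgDFT` is homogeneous. [folklore] -/
theorem cfgDFT_smul' (a : ℂ) (F : Cfg L → ℂ) (k₂ k₃ : Tor L) :
    cfgDFT L (fun c => a * F c) k₂ k₃ = a * cfgDFT L F k₂ k₃ := by
  unfold cfgDFT; rw [Finset.mul_sum]; exact Finset.sum_congr rfl fun c _ => by ring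

/-- `cfgDFT` of a four-direction sum. [folklore] -/
theorem cfgDFT_nnsum (T : Tor L → Cfg L → ℂ) (k₂ k₃ : Tor L) :
    cfgDFT L (fun c => ((nnList L).map (fun e => T e c)).sum) k₂ k₃ = ((nnList L).map (fun e => cfgDFT L (T e) k₂ k₃)).sum := by
  unfold cfgDFT
  simp only [nnList_map_sum_complex]
  simp only [mul_add, Finset.sum_add_distrib]

/-- the transform of a `prod3` with slot transforms substituted (`TripleConvolution` as `tconv`). [folklore] -/
theorem cfgDFT_prod3_tconv (g₁ g₂ g₃ : Tor L → ℝ) (k₂ k₃ : Tor L) :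
    cfgDFT L (fun c => ((prod3 L g₁ g₂ g₃ c : ℝ) : ℂ)) k₂ k₃ = tconv L (dft L g₃) (dft L g₁) (dft L g₂) k₂ k₃ := by
  rw [cfgDFT_prod3]; rfl

/-- transform of a lattice gradient as a function. [folklore] -/
theorem dft_Dgrad_fun (F : Tor L → ℝ) (e : Tor L) :
    dft L (fun r => Dgrad L F e r) = fun q => (1 - (starRingEnd ℂ) (phase L q e)) * dft L F q :=
  funext fun q => dgradTransform_holds L F e q

end RowD

/-- ★ **`C0MonoTransform L` holds.** [folklore] -/
theorem c0MonoTransform_holds : C0MonoTransform L := by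
  intro Fa Fb Fc k₂ k₃
  -- the monomial as `−½ Σ_e (prod3 + prod3 + prod3)`
  have hform : (fun c => ((c0form3 L Fa Fb Fc c : ℝ) : ℂ))
      = fun c => -(1 / 2 : ℂ) * ((nnList L).map (fun e =>
          ((prod3 L (fun r => Dgrad L Fa e r) (fun r => Dgrad L Fb e r) Fc c : ℝ) : ℂ)
          + ((prod3 L (fun r => Dgrad L Fa (-e) r) Fb (fun r => Dgrad L Fc e r) c : ℝ) : ℂ)
          + ((prod3 L Fa (fun r => Dgrad L Fb e r) (fun r => Dgrad L Fc e r) c : ℝ) : ℂ))).sum := by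
    funext c
    unfold c0form3 prod3
    rw [nnList_map_sum, RowD.nnList_map_sum_complex]
    push_cast
    ring
  rw [hform, RowD.cfgDFT_smul', RowD.cfgDFT_nnsum]
  congr 1
  simp only [RowD.cfgDFT_add', RowD.cfgDFT_prod3_tconv, RowD.dft_Dgrad_fun]

omit [NeZero L] in
/-- ★ **`FfacDictionary L` holds.** [folklore] -/
theorem ffacDictionary_holds : FfacDictionary L := by
  intro lam2 α β γ e q
  unfold Ffac FfacU Wfac
  constructor
  · push_cast; ring
  · push_cast; ring

end Summit.HubbardSuperconductivity.HubbardSuperconductivity.Theorems.AnisotropyChord.Transfer.Fibre3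

end
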